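import Summits.Ventures.HodgeRepro2.T5CMFieldConjugationCentral
import Summits.Ventures.HodgeRepro2.T5CMDecomposition
import Summits.Ventures.HodgeRepro2.T5CyclotomicSevenDegreeOnePrime
import Summits.Ventures.HodgeRepro2.T5SexticDecomposition

/-!
# EVERY SEXTIC GALOIS CM FIELD: the inert/split census with the cyclicity hypothesis DISCHARGED — a place `v` of `K⁺`
# above an unramified `p` stays prime in `K` iff `f(P/p)` is even, i.e. `f(P/p) ∈ {2, 6}`; `K⁺/ℚ` is a cyclic cubic field

Tier-5 support N2 / N3 / §G-N4.2 (seat p3, gen 80). File 97 (`T5CMDecomposition`) carries the decomposition-group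
criterion of row N2.2.5 for every CM field `K` Galois over `ℚ` UNDER THE HYPOTHESIS `[IsCyclic Gal(K/ℚ)]` (`2 ∣ e f ⟺ P ∩
K⁺` non-split; unramified: `2 ∣ f(P/p) ⟺` non-split), phrased on the prime `P.under (𝓞 K⁺)`; file 49
(`T5CyclicSubfieldGalois`) makes every intermediate field of such a `K` Galois over `ℚ` with cyclic group (Mathlib's
`IsAbelianGalois.tower_bot` does it for the subfield `K⁺` directly). File 280
proves that EVERY sextic Galois CM field has cyclic Galois group. This file puts the three together, for the brief's
«sextic Galois CM case» with NO cyclicity hypothesis, and in the cell's place-indexed vocabulary (`v : HeightOneSpectrum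
(𝓞 K⁺)`, `P` lying over `v`, «`v` stays prime ⟺ ∃ w, v 𝓞_K = w» — files 233 / 236 / 279):

* cyclic `Gal(K/ℚ)`, place-indexed: `ncard_primesOver_eq_one_iff_two_dvd` (`v` non-split `⟺ 2 ∣ e(P/p) f(P/p)`),
  `ncard_primesOver_eq_one_iff_even_inertiaDeg`, **`exists_map_eq_iff_even_inertiaDeg`** (`p` unramified: `v 𝓞_K = w`
  `⟺ f(P/p)` even), `ncard_primesOver_eq_two_iff_odd_inertiaDeg`;
* SEXTIC (`[K : ℚ] = 6`, no cyclicity hypothesis): `isCyclic_gal`, `isAbelianGalois_maximalRealSubfield`,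
  **`isGalois_maximalRealSubfield`**,
  `isCyclic_gal_maximalRealSubfield`, `finrank_maximalRealSubfield` (`= 3`: `K⁺` is a cyclic cubic field),
  `inertiaDeg_under_eq_one_or_three` (`f(v/p) ∈ {1, 3}`), `ncard_primesOver_eq_one_iff_two_dvd_sextic`,
  **`exists_map_eq_iff_even_inertiaDeg_sextic`**, `even_inertiaDeg_iff_sextic` (`f ∣ 6`: even `⟺ f = 2 ∨ f = 6`),
  **`ncard_primesOver_eq_one_iff_inertiaDeg_eq_two_or_six`**.

§8(d): uses an L-value-free non-vanishing device: NO.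
-/

open NumberField NumberField.IsCMField IsDedekindDomain IsDedekindDomain.HeightOneSpectrum MulAction
open scoped Pointwise

namespace Summit.Ventures.HodgeRepro2.T5CMFieldCyclicGaloisCriterion

section Cyclic

variable (K : Type*) [Field K] [NumberField K] [IsCMField K] [IsGalois ℚ K] [IsCyclic (K ≃ₐ[ℚ] K)]
variable (p : ℕ) [hp : Fact p.Prime]
variable (P : Ideal (𝓞 K)) [hP : P.IsPrime] [hPp : P.LiesOver (Ideal.span {(p : ℤ)})]
variable (v : HeightOneSpectrum (𝓞 (maximalRealSubfield K))) [hPv : P.LiesOver v.asIdeal]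

include p hp hPp in
/-- **A place `v` of `K⁺` has ONE prime of `K` above it iff `2 ∣ e(P/p) f(P/p)`** for any prime `P` of `K` above `v`
and `p` (`Gal(K/ℚ)` cyclic) — file 97's `two_dvd_ramificationIdx_mul_inertiaDeg_iff` with `P.under (𝓞 K⁺) = v`. -/
theorem ncard_primesOver_eq_one_iff_two_dvd :
    (v.asIdeal.primesOver (𝓞 K)).ncard = 1 ↔ 2 ∣ P.ramificationIdx ℤ * P.inertiaDeg ℤ := by
  have h := T5CMDecomposition.two_dvd_ramificationIdx_mul_inertiaDeg_iff K hp.out P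
  rw [← Ideal.over_def P v.asIdeal] at h
  exact h.symm

include p hp hPp in
/-- **For `p` unramified in `K`: `v` has one prime of `K` above it iff `f(P/p)` is EVEN.** -/
theorem ncard_primesOver_eq_one_iff_even_inertiaDeg (he : P.ramificationIdx ℤ = 1) :
    (v.asIdeal.primesOver (𝓞 K)).ncard = 1 ↔ Even (P.inertiaDeg ℤ) := by
  rw [ncard_primesOver_eq_one_iff_two_dvd K p P v, he, one_mul, even_iff_two_dvd]

omit [IsCMField K] [IsGalois ℚ K] [IsCyclic (K ≃ₐ[ℚ] K)] hP in
include v hPv in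
/-- `e(P/v) = 1` when `e(P/p) = 1` (the tower law `e(P/p) = e(v/p) e(P/v)`). -/
theorem ramificationIdx_over_eq_one_of_eq_one (he : P.ramificationIdx ℤ = 1) :
    P.ramificationIdx (𝓞 (maximalRealSubfield K)) = 1 := by
  have htower := Ideal.ramificationIdx_tower (R := ℤ) v.asIdeal P
  rw [he] at htower
  exact Nat.eq_one_of_mul_eq_one_left htower.symm

include p hp hPp in
/-- **For `p` unramified in `K`: `v` STAYS PRIME in `K` (`v 𝓞_K = w`) iff `f(P/p)` is EVEN** — file 272's criterion
for every CM field with cyclic Galois group over `ℚ` (file 279's «`v 𝓞_K = w ⟺ c • P = P`» and file 97's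
`complexConj_smul_eq_iff`). -/
theorem exists_map_eq_iff_even_inertiaDeg (he : P.ramificationIdx ℤ = 1) :
    (∃ w : HeightOneSpectrum (𝓞 K),
      Ideal.map (algebraMap (𝓞 (maximalRealSubfield K)) (𝓞 K)) v.asIdeal = w.asIdeal) ↔
      Even (P.inertiaDeg ℤ) := by
  rw [T5CMFieldConjugationDecomposition.exists_map_eq_iff_smul_eq K v P
    (ramificationIdx_over_eq_one_of_eq_one K P v he), T5CMDecomposition.complexConj_smul_eq_iff K P,
    ← Ideal.over_def P v.asIdeal, ncard_primesOver_eq_one_iff_even_inertiaDeg K p P v he]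

include p hp hPp in
/-- **For `p` unramified in `K`: TWO primes of `K` above `v` iff `f(P/p)` is ODD.** -/
theorem ncard_primesOver_eq_two_iff_odd_inertiaDeg (he : P.ramificationIdx ℤ = 1) :
    (v.asIdeal.primesOver (𝓞 K)).ncard = 2 ↔ Odd (P.inertiaDeg ℤ) := by
  rw [← Nat.not_even_iff_odd, ← ncard_primesOver_eq_one_iff_even_inertiaDeg K p P v he]
  rcases T5FinitePlaceSplitIff.ncard_primesOver_eq_one_or_two K v with h | h <;> rw [h] <;> norm_num

end Cyclic

section Sextic

variable (K : Type*) [Field K] [NumberField K] [IsCMField K] [IsGalois ℚ K] (h6 : Module.finrank ℚ K = 6)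
include h6

/-- **A sextic Galois CM field has cyclic Galois group** (file 280), restated here as the section's entry point. -/
theorem isCyclic_gal : IsCyclic (K ≃ₐ[ℚ] K) := T5CMFieldConjugationCentral.isCyclic_gal_of_finrank_eq_six K h6

/-- **`K⁺/ℚ` is abelian** for every sextic Galois CM field `K` (Mathlib's `IsAbelianGalois.of_isCyclic` and
`IsAbelianGalois.tower_bot` on the tower `ℚ ⊆ K⁺ ⊆ K`). -/
theorem isAbelianGalois_maximalRealSubfield : IsAbelianGalois ℚ (maximalRealSubfield K) :=
  haveI := isCyclic_gal K h6
  haveI : IsAbelianGalois ℚ K := IsAbelianGalois.of_isCyclic ℚ K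
  IsAbelianGalois.tower_bot ℚ (maximalRealSubfield K) K

/-- **`K⁺/ℚ` is Galois** for every sextic Galois CM field `K`. -/
theorem isGalois_maximalRealSubfield : IsGalois ℚ (maximalRealSubfield K) :=
  (isAbelianGalois_maximalRealSubfield K h6).toIsGalois

/-- **`Gal(K⁺/ℚ)` is cyclic** for every sextic Galois CM field `K`: it is the image of the cyclic `Gal(K/ℚ)` under
the restriction map (Mathlib's `AlgEquiv.restrictNormalHom_surjective`). -/
theorem isCyclic_gal_maximalRealSubfield :
    IsCyclic (maximalRealSubfield K ≃ₐ[ℚ] maximalRealSubfield K) :=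
  haveI := isCyclic_gal K h6
  haveI := isGalois_maximalRealSubfield K h6
  isCyclic_of_surjective (AlgEquiv.restrictNormalHom (F := ℚ) (K₁ := K) (maximalRealSubfield K))
    (AlgEquiv.restrictNormalHom_surjective (F := ℚ) (K₁ := maximalRealSubfield K) K)

omit [IsGalois ℚ K] in
/-- **`[K⁺ : ℚ] = 3`**: `K⁺` is a cyclic cubic field (the tower law with `[K : K⁺] = 2`). -/
theorem finrank_maximalRealSubfield : Module.finrank ℚ (maximalRealSubfield K) = 3 := by
  have h := Module.finrank_mul_finrank ℚ (maximalRealSubfield K) K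
  rw [Algebra.IsQuadraticExtension.finrank_eq_two (maximalRealSubfield K) K, h6] at h
  omega

variable (p : ℕ) [hp : Fact p.Prime]

/-- **`f(v/p) ∈ {1, 3}`** for every place `v` of `K⁺` above `p` (file 264's `inertiaDeg_dvd_finrank_of_isGalois` on
the Galois cubic `K⁺`). -/
theorem inertiaDeg_under_eq_one_or_three (v : HeightOneSpectrum (𝓞 (maximalRealSubfield K)))
    [hv : v.asIdeal.LiesOver (Ideal.span {(p : ℤ)})] :
    v.asIdeal.inertiaDeg ℤ = 1 ∨ v.asIdeal.inertiaDeg ℤ = 3 := by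
  haveI := isGalois_maximalRealSubfield K h6
  have hdvd := T5CyclotomicSevenDegreeOnePrime.inertiaDeg_dvd_finrank_of_isGalois (maximalRealSubfield K) p v.asIdeal
  rw [finrank_maximalRealSubfield K h6] at hdvd
  exact (Nat.dvd_prime Nat.prime_three).mp hdvd

variable (P : Ideal (𝓞 K)) [hP : P.IsPrime] [hPp : P.LiesOver (Ideal.span {(p : ℤ)})]
variable (v : HeightOneSpectrum (𝓞 (maximalRealSubfield K))) [hPv : P.LiesOver v.asIdeal]

include p hp hPp in
/-- **SEXTIC GALOIS CM FIELDS: `v` non-split in `K` iff `2 ∣ e(P/p) f(P/p)`** — no cyclicity hypothesis. -/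
theorem ncard_primesOver_eq_one_iff_two_dvd_sextic :
    (v.asIdeal.primesOver (𝓞 K)).ncard = 1 ↔ 2 ∣ P.ramificationIdx ℤ * P.inertiaDeg ℤ :=
  haveI := isCyclic_gal K h6
  ncard_primesOver_eq_one_iff_two_dvd K p P v

include p hp hPp in
/-- **SEXTIC GALOIS CM FIELDS, `p` unramified: `v` stays prime in `K` iff `f(P/p)` is even.** -/
theorem exists_map_eq_iff_even_inertiaDeg_sextic (he : P.ramificationIdx ℤ = 1) :
    (∃ w : HeightOneSpectrum (𝓞 K),
      Ideal.map (algebraMap (𝓞 (maximalRealSubfield K)) (𝓞 K)) v.asIdeal = w.asIdeal) ↔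
      Even (P.inertiaDeg ℤ) :=
  haveI := isCyclic_gal K h6
  exists_map_eq_iff_even_inertiaDeg K p P v he

omit [IsCMField K] in
include p hp hPp in
/-- In a sextic Galois field `f(P/p) ∣ 6`, so `f(P/p)` is even iff `f(P/p) ∈ {2, 6}` (file 63's
`inertiaDeg_dvd_finrank`). -/
theorem even_inertiaDeg_iff_sextic :
    Even (P.inertiaDeg ℤ) ↔ P.inertiaDeg ℤ = 2 ∨ P.inertiaDeg ℤ = 6 := by
  have hdvd : P.inertiaDeg ℤ ∣ 6 := h6 ▸ T5SexticDecomposition.inertiaDeg_dvd_finrank hp.out P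
  have hpos : 0 < P.inertiaDeg ℤ := Nat.pos_of_dvd_of_pos hdvd (by norm_num)
  have hle : P.inertiaDeg ℤ ≤ 6 := Nat.le_of_dvd (by norm_num) hdvd
  rw [Nat.even_iff]
  generalize P.inertiaDeg ℤ = f at hdvd hpos hle ⊢
  interval_cases f <;> first | decide | (norm_num at hdvd)

include p hp hPp in
/-- **SEXTIC GALOIS CM FIELDS, `p` unramified: `v` has ONE prime of `K` above it iff `f(P/p) = 2` or `f(P/p) = 6`**
(the inert places of the brief's case: residue degree `2` — `p` splits in the cubic `K⁺` and each place stays prime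
in `K` — or `6` — `p` inert in `K`). -/
theorem ncard_primesOver_eq_one_iff_inertiaDeg_eq_two_or_six (he : P.ramificationIdx ℤ = 1) :
    (v.asIdeal.primesOver (𝓞 K)).ncard = 1 ↔ P.inertiaDeg ℤ = 2 ∨ P.inertiaDeg ℤ = 6 := by
  haveI := isCyclic_gal K h6
  rw [ncard_primesOver_eq_one_iff_even_inertiaDeg K p P v he, even_inertiaDeg_iff_sextic K h6 p P]

end Sextic

section Frobenius

/-! ### v2 (append-only): the Frobenius reading of row N2.2.5 on every sextic Galois CM field
«a place of `K⁺` above `p` is non-split in `K` iff `Frob_p` has even order» — file 97's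
`ncard_primesOver_eq_one_iff_two_dvd_orderOf_frobD` (cyclic `Gal(K/ℚ)`, `Frob_P` = file 68's arithmetic Frobenius
`frobD`, of order `f(P/p)` for unramified `p`) with the cyclicity discharged by file 280. -/

variable (K : Type*) [Field K] [NumberField K] [IsCMField K] [IsGalois ℚ K] (h6 : Module.finrank ℚ K = 6)
variable (p : ℕ) [hp : Fact p.Prime]
variable (P : Ideal (𝓞 K)) [hP : P.IsPrime] [hPp : P.LiesOver (Ideal.span {(p : ℤ)})]
variable (v : HeightOneSpectrum (𝓞 (maximalRealSubfield K))) [hPv : P.LiesOver v.asIdeal]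
include h6 p hp hPp

/-- **SEXTIC GALOIS CM FIELDS, `p` unramified: `v` has ONE prime of `K` above it iff the Frobenius `Frob_P` has EVEN
order** (file 97's criterion, cyclicity discharged). -/
theorem ncard_primesOver_eq_one_iff_two_dvd_orderOf_frobD_sextic (he : P.ramificationIdx ℤ = 1) :
    (v.asIdeal.primesOver (𝓞 K)).ncard = 1 ↔ 2 ∣ orderOf (T5FrobeniusGenerates.frobD hp.out P) := by
  haveI := isCyclic_gal K h6
  have h := T5CMDecomposition.ncard_primesOver_eq_one_iff_two_dvd_orderOf_frobD K hp.out P he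
  rw [← Ideal.over_def P v.asIdeal] at h
  exact h

/-- **SEXTIC GALOIS CM FIELDS, `p` unramified: `v` stays prime in `K` iff `Frob_P` has even order** — row N2.2.5's
printed sentence on every sextic Galois CM field. -/
theorem exists_map_eq_iff_two_dvd_orderOf_frobD_sextic (he : P.ramificationIdx ℤ = 1) :
    (∃ w : HeightOneSpectrum (𝓞 K),
      Ideal.map (algebraMap (𝓞 (maximalRealSubfield K)) (𝓞 K)) v.asIdeal = w.asIdeal) ↔
      2 ∣ orderOf (T5FrobeniusGenerates.frobD hp.out P) := by
  rw [exists_map_eq_iff_even_inertiaDeg_sextic K h6 p P v he, T5FrobeniusGenerates.orderOf_frobD hp.out P he,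
    even_iff_two_dvd]

end Frobenius

end Summit.Ventures.HodgeRepro2.T5CMFieldCyclicGaloisCriterion
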